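/-
Copyright (c) 2026. All rights reserved.
Released under Apache 2.0 license as described in the file LICENSE.
Authors: HodgeCM publication cell (pub-hodgecm), model-construction sub-cell, discharge seat `mc-discharge-2`.
-/
import Literature.NumberTheory.GelbartRogawski1991.UnitaryDualPairThetaKernelCM
import Literature.NumberTheory.Automorphic.UnitaryGroupSymplecticFiniteAdelic
import Literature.NumberTheory.Automorphic.UnitaryGroupDirectSumCarriers
import Literature.NumberTheory.Weil1964.ArchSchrodingerFollandDictionary
import HarnessLib

-- buildfix G11b-3 recipe (LEDGER B13-1/B13-3): elaborate sequentially so the trailing `attribute [implicit_reducible]`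
-- block (reducibilityCoreExt is keyed to the async environment branch) is in force at `.olean` export.
set_option Elab.async false

/-!
# The pair splitting at finite-adelic points: trivial archimedean symplectic component (`harch`)

Topic `NumberTheory/GelbartRogawski1991`; namespace `Literature.NumberTheory.GelbartRogawski1991.UnitaryDualPair`
(continues `UnitaryDualPairSplittingDatum` / `UnitaryDualPairThetaKernel` / `UnitaryDualPairThetaKernelCM`). KERNEL
ONLY: 0 definitions, 0 records, 0 named facts; every statement proved from the tree.

For a COMPATIBLE splitting `s` of the dual-pair datum of [GelbartRogawski1991, §3.1 Prop. 3.1.1] the pair splitting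
`s_pair : U(J_V)(𝔸_F) × U(J_W)(𝔸_F) →* Mp_ψ(𝕎_𝔸)ᶜᵒⁿᵗ` lies over `ι = toSp` (`proj_pairSplitting`). Read on the
finite-adelic points `k ↦ (1, k)` (`UnitaryGroup.finAdelicToAdelic`) its symplectic component has ARCHIMEDEAN COMPONENT
`1`, hence fixes every archimedean vector `(archVec a, archVec w)` of `𝕎_𝔸 = 𝔸_F^n × 𝔸_F^n`
(`Automorphic/UnitaryGroupSymplecticFiniteAdelic`, read through the enumeration `e` by `coe_spReindex_apply`):

* §1 `toSp_finAdelic_apply_eq_self` (`ι((1,k) ⊗ (1,u))` fixes vectors with zero finite components),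
  `proj_pairSplitting_finAdelic_apply_archVec`, and — in the shape consumed by
  `Weil1964/FiniteWeilLevelFixing` / `SchwartzIndicatorDeepLevelFixed` / `AdelicMetaplecticFinRep.finRepMp` —
  **`harch_pairSplitting_fin`**: for `s_fin := s_pair ∘ (k ↦ ((1,k), 1))`
  (`(pairSplitting s).comp ((MonoidHom.inl _ _).comp finAdelicToAdelic)`),
  `∀ k a w, (π (s_fin k)).1 (archVec a, archVec w) = (archVec a, archVec w)`; `continuous_pairSplitting_fin`.
* §2 the CM specialisation at the pair splitting OF RECORD `σ := cmPairSplitting … hGR` of `UnitaryDualPairThetaKernelCM`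
  (`F := L⁺`, `E := L`, `c :=` complex conjugation, diagonal frames): **`harch_cmPairSplitting_fin`** and
  **`continuous_cmPairSplitting_fin`** — the two inputs (`harch`, `hs`) under which the deep-level fixing theorems
  instantiate at `s := σ.comp ((MonoidHom.inl _ _).comp (UnitaryGroup.finAdelicToAdelic …))`.

USE (pub-hodgecm model layer; asked for by name by the theta lane, E-binder `C`, fields `fixN`/`sat`/`level` of
`ArchKTypeData.ofArchRead` at `Γ₀ := (Γ(M), K(M))`, `K₂ := K_{U,f}(M𝓞_L)`): nothing here is specific to that use.

References (provenance): S. Gelbart, J. Rogawski, Invent. Math. 105 (1991), §3.1 pp. 454–455 (`G(𝐀) ⊂ Sp_𝐀(W)`,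
Prop. 3.1.1); A. Borel, H. Jacquet, Proc. Sympos. Pure Math. 33.1 (1979), §4.1 (`G(𝔸) = G_∞ × G(𝔸_f)`).
-/

set_option autoImplicit false

noncomputable section

open scoped Matrix Kronecker
open NumberField NumberField.mixedEmbedding IsDedekindDomain
open Literature.NumberTheory.Automorphic
open Literature.NumberTheory.Automorphic.UnitaryGroup
open Literature.NumberTheory.Weil1964

namespace Literature.NumberTheory.GelbartRogawski1991

namespace UnitaryDualPair

/-! ## §1. Generic quadratic extension `E/F` -/

section Generic

variable (F E : Type) [Field F] [NumberField F] [Field E] [NumberField E] [Algebra F E]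
variable (c : E ≃ₐ[F] E) (N M : ℕ) {n : ℕ} (e : Fin N × Fin M ≃ Fin n)
variable (JV : Matrix (Fin N) (Fin N) E) (JW : Matrix (Fin M) (Fin M) E)
variable {TV : Matrix (Fin N) (Fin N) F} {TW : Matrix (Fin M) (Fin M) F}
variable [Algebra.IsQuadraticExtension F E] {δ : E} (hcδ : c δ = -δ) (hδ : δ ≠ 0) {d : F}
  (hd : δ * δ = algebraMap F E d) (hV : TV.IsSymm) (hW : TW.IsSymm) (hVd : IsUnit TV.det) (hWd : IsUnit TW.det)
  (hJV : JV = TV.map (algebraMap F E)) (hJW : JW = TW.map (algebraMap F E))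

/-- **`ι((1,k) ⊗ (1,u))` fixes every vector of `𝕎_𝔸 = 𝔸_F^n × 𝔸_F^n` with zero finite components** (`toSp` is
`adelicPairToSymplectic` read through `e`, `coe_spReindex_apply`; reindexing preserves "zero finite components").
[cite: GelbartRogawski1991, §3.1 p. 454] -/
theorem toSp_finAdelic_apply_eq_self (k : finAdelic F E c N JV) (u : finAdelic F E c M JW)
    (V : (Fin n → AdeleRing (𝓞 F) F) × (Fin n → AdeleRing (𝓞 F) F)) (hV₁ : ∀ i, (V.1 i).2 = 0)
    (hV₂ : ∀ i, (V.2 i).2 = 0) :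
    (toSp F E c N M e JV JW hcδ hδ hd hV hW hJV hJW
        (adelicInl F E c N M JV JW (finAdelicToAdelic F E c N JV k) *
          adelicInr F E c N M JV JW (finAdelicToAdelic F E c M JW u))).1 V = V := by
  rw [adelicInl_mul_adelicInr, toSp_apply, coe_spReindex_apply,
    adelicPairToSymplectic_dualPair_finAdelicToAdelic_apply_eq_self F E c N M hcδ hδ hd hV hW hJV hJW k u
      ((reindexW (AdeleRing (𝓞 F) F) e).symm V) (fun i => hV₁ (e i)) (fun i => hV₂ (e i))]
  exact (reindexW (AdeleRing (𝓞 F) F) e).apply_symm_apply V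

/-- The `U(J_V)`-member alone: `ι((1,k) ⊗ 1)` fixes every vector with zero finite components.
[cite: GelbartRogawski1991, §3.1 p. 454] -/
theorem toSp_adelicInl_finAdelic_apply_eq_self (k : finAdelic F E c N JV)
    (V : (Fin n → AdeleRing (𝓞 F) F) × (Fin n → AdeleRing (𝓞 F) F)) (hV₁ : ∀ i, (V.1 i).2 = 0)
    (hV₂ : ∀ i, (V.2 i).2 = 0) :
    (toSp F E c N M e JV JW hcδ hδ hd hV hW hJV hJW (adelicInl F E c N M JV JW (finAdelicToAdelic F E c N JV k))).1 V =
      V := by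
  rw [toSp_apply, coe_spReindex_apply,
    adelicPairToSymplectic_adelicInl_finAdelicToAdelic_apply_eq_self F E c N M hcδ hδ hd hV hW hJV hJW k
      ((reindexW (AdeleRing (𝓞 F) F) e).symm V) (fun i => hV₁ (e i)) (fun i => hV₂ (e i))]
  exact (reindexW (AdeleRing (𝓞 F) F) e).apply_symm_apply V

variable {s : adelicPair F E c N M JV JW →* adelicMpCont F (Fin n) (adelicGram F e TV TW)}

/-- **For a compatible splitting, `π(s_pair((1,k), (1,u)))` fixes the archimedean vectors `(archVec a, archVec w)`.**
[cite: GelbartRogawski1991, §3.1 Prop. 3.1.1 p. 455 L1–3] -/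
theorem proj_pairSplitting_finAdelic_apply_archVec
    (hs : (splittingDatum F E c N M e JV JW hcδ hδ hd hV hW hVd hWd hJV hJW).IsCompatible s)
    (k : finAdelic F E c N JV) (u : finAdelic F E c M JW) (a w : Fin n → mixedSpace F) :
    (adelicMpCont.proj F (Fin n) (adelicGram F e TV TW)
        (pairSplitting F E c N M e JV JW s (finAdelicToAdelic F E c N JV k, finAdelicToAdelic F E c M JW u))).1
        (archVec F (Fin n) a, archVec F (Fin n) w) =
      (archVec F (Fin n) a, archVec F (Fin n) w) := by
  rw [proj_pairSplitting F E c N M e JV JW hcδ hδ hd hV hW hVd hWd hJV hJW hs]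
  exact toSp_finAdelic_apply_eq_self F E c N M e JV JW hcδ hδ hd hV hW hJV hJW k u _
    (fun i => archVec_apply_snd a i) (fun i => archVec_apply_snd w i)

/-- **`harch` for `s_fin := s_pair ∘ (k ↦ ((1,k), 1))`** — the hypothesis of `FiniteWeilLevelFixing` /
`SchwartzIndicatorDeepLevelFixed` / `AdelicMetaplecticFinRep.finRepMp` at the finite-adelic points of `U(J_V)`.
[cite: GelbartRogawski1991, §3.1 Prop. 3.1.1 p. 455 L1–3] -/
theorem harch_pairSplitting_fin
    (hs : (splittingDatum F E c N M e JV JW hcδ hδ hd hV hW hVd hWd hJV hJW).IsCompatible s)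
    (k : finAdelic F E c N JV) (a w : Fin n → mixedSpace F) :
    (adelicMpCont.proj F (Fin n) (adelicGram F e TV TW)
        (((pairSplitting F E c N M e JV JW s).comp
          ((MonoidHom.inl _ _).comp (finAdelicToAdelic F E c N JV))) k)).1
        (archVec F (Fin n) a, archVec F (Fin n) w) =
      (archVec F (Fin n) a, archVec F (Fin n) w) := by
  -- `π(s_fin k) = ι((1,k) ⊗ 1)` (term-mode chain: `rw` under the heavy carrier `s` is prohibitively slow)
  have hproj : adelicMpCont.proj F (Fin n) (adelicGram F e TV TW)
      (((pairSplitting F E c N M e JV JW s).comp ((MonoidHom.inl _ _).comp (finAdelicToAdelic F E c N JV))) k) =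
      toSp F E c N M e JV JW hcδ hδ hd hV hW hJV hJW (adelicInl F E c N M JV JW (finAdelicToAdelic F E c N JV k)) :=
    (proj_pairSplitting F E c N M e JV JW hcδ hδ hd hV hW hVd hWd hJV hJW hs (finAdelicToAdelic F E c N JV k, 1)).trans
      (congrArg (fun x => toSp F E c N M e JV JW hcδ hδ hd hV hW hJV hJW x) (by rw [map_one, mul_one]))
  rw [hproj]
  exact toSp_adelicInl_finAdelic_apply_eq_self F E c N M e JV JW hcδ hδ hd hV hW hJV hJW k _
    (fun i => archVec_apply_snd a i) (fun i => archVec_apply_snd w i)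

omit [Algebra.IsQuadraticExtension F E] in
/-- `s_fin` is continuous when `s_pair` is. [cite: GelbartRogawski1991, §3.1 Prop. 3.1.1 p. 455 L1–3] -/
theorem continuous_pairSplitting_fin (hc : Continuous (pairSplitting F E c N M e JV JW s)) :
    Continuous ((pairSplitting F E c N M e JV JW s).comp
      ((MonoidHom.inl _ _).comp (finAdelicToAdelic F E c N JV))) :=
  hc.comp ((continuous_finAdelicToAdelic F E c N JV).prodMk continuous_const)

end Generic

/-! ## §2. The CM pair splitting of record -/

section CM

variable (L : Type) [Field L] [NumberField L] [IsCMField L] {N M n : ℕ} (e : Fin N × Fin M ≃ Fin n)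
variable (dV : Fin N → L) (hdV : ∀ i, IsCMField.complexConj L (dV i) = dV i) (hdV0 : ∀ i, dV i ≠ 0)
variable (dW : Fin M → L) (hdW : ∀ i, IsCMField.complexConj L (dW i) = dW i) (hdW0 : ∀ i, dW i ≠ 0)

/-- **`harch` at the CM pair splitting of record**: for `σ := cmPairSplitting … hGR` and
`s := σ.comp ((MonoidHom.inl _ _).comp (UnitaryGroup.finAdelicToAdelic …))` (the finite-adelic points of
`U(diag dV)(𝔸_{L⁺})` read in the first slot), every symplectic component `π(s k)` fixes the archimedean vectors.
[cite: GelbartRogawski1991, §3.1 Prop. 3.1.1 p. 455 L1–3] -/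
theorem harch_cmPairSplitting_fin (hGR : (cmSplittingDatum L e dV hdV hdV0 dW hdW hdW0).CompatibleSplitting)
    (k : finAdelic (↥(maximalRealSubfield L)) L (IsCMField.complexConj L) N (Matrix.diagonal dV))
    (a w : Fin n → mixedSpace (↥(maximalRealSubfield L))) :
    (adelicMpCont.proj (↥(maximalRealSubfield L)) (Fin n)
        (adelicGram (↥(maximalRealSubfield L)) e (realDiagonal L dV hdV) (realDiagonal L dW hdW))
        (((cmPairSplitting L e dV hdV hdV0 dW hdW hdW0 hGR).comp
          ((MonoidHom.inl _ _).comp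
            (finAdelicToAdelic (↥(maximalRealSubfield L)) L (IsCMField.complexConj L) N (Matrix.diagonal dV)))) k)).1
        (archVec (↥(maximalRealSubfield L)) (Fin n) a, archVec (↥(maximalRealSubfield L)) (Fin n) w) =
      (archVec (↥(maximalRealSubfield L)) (Fin n) a, archVec (↥(maximalRealSubfield L)) (Fin n) w) :=
  harch_pairSplitting_fin (↥(maximalRealSubfield L)) L (IsCMField.complexConj L) N M e (Matrix.diagonal dV)
    (Matrix.diagonal dW) (complexConj_imagUnit L) (imagUnit_ne_zero L) (imagUnit_mul_self L)
    (realDiagonal_isSymm L dV hdV) (realDiagonal_isSymm L dW hdW)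
    (isUnit_det_realDiagonal L dV hdV hdV0) (isUnit_det_realDiagonal L dW hdW hdW0)
    (realDiagonal_map L dV hdV).symm (realDiagonal_map L dW hdW).symm
    (splittingOf_isCompatible _ _ _ _ _ _ _ _ _ _ _ _ _ _ _ _ _ hGR) k a w

/-- **`hs` at the CM pair splitting of record**: `s := σ.comp ((MonoidHom.inl _ _).comp finAdelicToAdelic)` is
continuous. [cite: GelbartRogawski1991, §3.1 Prop. 3.1.1 p. 455 L1–3] -/
theorem continuous_cmPairSplitting_fin (hGR : (cmSplittingDatum L e dV hdV hdV0 dW hdW hdW0).CompatibleSplitting) :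
    Continuous ((cmPairSplitting L e dV hdV hdV0 dW hdW hdW0 hGR).comp
      ((MonoidHom.inl _ _).comp
        (finAdelicToAdelic (↥(maximalRealSubfield L)) L (IsCMField.complexConj L) N (Matrix.diagonal dV)))) :=
  (continuous_cmPairSplitting L e dV hdV hdV0 dW hdW hdW0 hGR).comp
    ((continuous_finAdelicToAdelic _ L _ N _).prodMk continuous_const)

end CM

/-! ### Build-lane note (ops-buildfix G11b-3 recipe, LEDGER B13-1, 2026-08-21)
`lean -o` (the hub build lane, never `lean`/the gate check) runs Lean 4.32's library-suggestion indexers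
(`Lean.LibrarySuggestions.SymbolFrequency` / `SineQuaNon`, from their `exportEntriesFn`) over the statement of
every local theorem that is not a denied premise; on this family's statements (very large dependent binder
telescopes through the theta-kernel / dual-pair data) that fold runs for tens of minutes to hours and the build
lane kills the job (incident G11b-3, run/shared/lean/ops/buildfix/G11b-3-DOSSIER.md). `isDeniedPremise` skips
`[implicit_reducible]` constants before any fold, and a reducibility status on a *theorem* is inert (Meta never
unfolds `thmInfo`; the kernel ignores the attribute), so the public theorems of this file are tagged
`[implicit_reducible]` purely to keep them out of that index. Only other effect: they are not offered by
`+suggestions` premise selectors. No statement or proof is changed; superseded if the operator lands a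
deny-list form (`HarnessLib.PremiseIndex`). -/
set_option allowUnsafeReducibility true in
attribute [implicit_reducible]
  toSp_finAdelic_apply_eq_self toSp_adelicInl_finAdelic_apply_eq_self
  proj_pairSplitting_finAdelic_apply_archVec harch_pairSplitting_fin continuous_pairSplitting_fin
  harch_cmPairSplitting_fin continuous_cmPairSplitting_fin

end UnitaryDualPair

end Literature.NumberTheory.GelbartRogawski1991
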